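import Literature.NumberTheory.LFunctions.WeilFirstPrimeCertificateDataC
import HarnessLib

/-!
# First-prime Weil positivity, stage C: kernel check of the even scaled moments ν_12, ν_14, ν_16, ν_18, ν_20, ν_22

Part of `weilCert3C.check` (`WeilFirstPrimeCertificateDataC.lean`), evaluated by `decide +kernel` and kept in its own
file for kernel time and memory (each declaration is checked separately). Assembled in
`WeilFirstPrimeCertificateCCheck.lean`. Pure proof file; nothing is asserted.
-/

noncomputable section

namespace Literature.NumberTheory.LFunctions

set_option maxHeartbeats 0 in
/-- **Kernel check of the scaled moment `ν_{12}`** of the stage-C first-prime certificate. [folklore] -/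
theorem checkNuAt12_weilCert3C : weilCert3C.checkNuAt 12 = true := by
  decide +kernel

set_option maxHeartbeats 0 in
/-- **Kernel check of the scaled moment `ν_{14}`** of the stage-C first-prime certificate. [folklore] -/
theorem checkNuAt14_weilCert3C : weilCert3C.checkNuAt 14 = true := by
  decide +kernel

set_option maxHeartbeats 0 in
/-- **Kernel check of the scaled moment `ν_{16}`** of the stage-C first-prime certificate. [folklore] -/
theorem checkNuAt16_weilCert3C : weilCert3C.checkNuAt 16 = true := by
  decide +kernel

set_option maxHeartbeats 0 in
/-- **Kernel check of the scaled moment `ν_{18}`** of the stage-C first-prime certificate. [folklore] -/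
theorem checkNuAt18_weilCert3C : weilCert3C.checkNuAt 18 = true := by
  decide +kernel

set_option maxHeartbeats 0 in
/-- **Kernel check of the scaled moment `ν_{20}`** of the stage-C first-prime certificate. [folklore] -/
theorem checkNuAt20_weilCert3C : weilCert3C.checkNuAt 20 = true := by
  decide +kernel

set_option maxHeartbeats 0 in
/-- **Kernel check of the scaled moment `ν_{22}`** of the stage-C first-prime certificate. [folklore] -/
theorem checkNuAt22_weilCert3C : weilCert3C.checkNuAt 22 = true := by
  decide +kernel

end Literature.NumberTheory.LFunctions
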